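import Summits.AnomalousDissipation.AnomalousDissipation.Theorems.SawtoothPulseCascadeK2ConeGauge
import Summits.AnomalousDissipation.AnomalousDissipation.Theorems.SawtoothPulseCascadeK2InjectionCap5
import Summits.AnomalousDissipation.AnomalousDissipation.Theorems.SawtoothPulseCascadeK3LocalisedClosurePointGlueP

/-!
# K2 — S4 v7: the TYPED ASSEMBLY `K2GrowthCtgPointH_of'` of route-2's crux of record from the renewal cone with profile (S3′), the RESHAPED
# material representation (S-2′) and a numeric budget — §6 TABLES OF RECORD (R-b) + the v7 ENTRY BOOK `EntryBoundsW7` (arbiter A27-9 / A27-9′, R-1a)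

## CHANGES v6 → v7 (prover ad-k1loc-p3 g10; arbiter rulings A27-9 (1)/(4) 08:37:50Z and A27-9′ 08:58:39Z, 2026-08-29; memo `K2SPKTest-p4g19.md` §10.1/§10.5/§10.7-C,D;
## SINGLE SOURCE OF TRUTH for every typed cap = planner ad-ideate-p4 g19's `HOME/ad-ideate-p4/k2-spk/taskA/matrix_S7_cells.json` (law matrix v7 = v6 + 698 amended cells))
1. NEW §3b: `EntryBoundsW7 θ K₀ M D := EntryBoundsW θ K₀ M D ∧ BookV7 M` — the v6 entry clause (UNTOUCHED, kept for the record) AND the v7 LAW BOOK typed as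
   ≤-CAPS on the fresh-transfer family `M` (target `i = (t′,s′)` ← source `j = (t,s)`) on EXACTLY the amended cells of `matrix_S7_cells.json` (extended along each
   column / diagonal to all shells): (i) core→far PER CORE COLUMN `M (t′,s′) (t,s) ≤ coreFar7 t′ t s · 2⁻¹^(s′−5)`, `s ≤ 4 < 5 ≤ s′`, `coreFar7` = THE 20 CONSTANTS
   = (3/2)·E5 (all-class max, custody K ≤ 192 six classes ∪ j328085 K384) rounded UP to 1/1000; (ii-a) V←H echo diagonals `M (V,s′) (H,s′+Δ) ≤ echo7 Δ = (3/2)·E_Δ`,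
   `E = (28.6, 51.7, 45.5, 37.8, 30, 4)`, `Δ = 6…11`, for `s′ ≥ 2` (`s′ ≥ 3` at `Δ = 11`); (ii-b) V→H creation band `M (H,s′) (V,s′+Δ) ≤ band7 Δ = (3/2)·F_Δ`,
   `F = (1.13, 2.6, 2.45, 0.63, 0.18)`, `Δ = 2…6`, for `s′ ≥ bandStart Δ = 7/6/7/12/16` (below these thresholds the v6 law exceeds the flat constant and stays the
   witness, un-capped); (iii) H→H and EVERY other cell (core×core, the remaining far→core / far→far cells, all debris `D k`) NOT typed = free exactly as in v6.
   A cap is never below the certificate's witness value (checked cell by cell against `cells_v7`: 698/698 typed = amended, 0 exclusions) and never below (3/2)× the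
   measured class-max (A27-9′ (2)).  `≤` not `=` (A27-9′ (1): S3′ v7 STRONGER — witness pinned under the certified matrix —, S-2′ v7 WEAKER).
2. §6: BOTH STUBS RE-TYPED over `EntryBoundsW7 8 K₀c` (names unchanged): `stub_S3_cone : ConeP (EntryBoundsW7 8 K₀c) ρc ιc Pdc cRc Γc Ccc`,
   `stub_S2_matRep : MaterialRepresentation' (EntryBoundsW7 8 K₀c) ηc Bc ιc Pdc cRc`; composition `K2GrowthCtgPointH_holds` / `Target_holds` unchanged (generic in
   `Adm`); cone constants `ρc ηc K₀c Bc Γc Ccc` and tables `ιc Pdc cRc` UNCHANGED.  CERTIFICATE OF RECORD on the v7 matrix (p4, `taskA/profile7_rows.py` →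
   `taskA/profile_S4v7.json`, `taskA/tables7.py` → `taskA/t7-profile_S4v7.txt`; §10.7-C3/D; c = 3/50): ρ_floor = 52.29 ≤ ρc = 53.6 (tight rows H7, V8, H6, H8),
   κ0 8.78 / κ1 23.32 / κ2 3635.11 (argmax (H,4)), Σκρ^{−n} 10.889, Σϖρ^{−k} 57.206, Γ = 622.9 ≤ Γc = 730, budget BΓ + Cc = 638.1 ≤ 3540.25 — PASS, NOT a Lean proof.
3. NEW §5b bridges (proved): `coneP_mono` / `genBook_anti` / `matRepAt'_anti` / `materialRepresentation'_anti` (ConeP monotone, MatRep′ antitone in `Adm`), whence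
   `coneP_W_of_W7` (S3′ v7 ⇒ S3′ v6) and `matRep_W7_of_W` (S-2′ v6 ⇒ S-2′ v7), and `renewalConeInvariant_of_coneP7` (projection to p4's frozen cone).
Everything else byte-identical to v6 (16f86d2059e2c869, the registered skeleton of 20024 since 06:33Z).  `lean check`: rc 0, sorries 2 (the two stubs).

## v6 header (prover ad-k1loc-p3 g9), kept
prover ad-k1loc-p3 g9, crux workfile on the dir of stmt-AnomalousDissipation-19491; supersedes v5′ (c0b127802908, sha16 4761b4cd025809ca = the REGISTERED
skeleton of Target stmt-AnomalousDissipation-20024, A26-14).  **v6 = v5 (3174996f6da4) + v5′'s single intended change, nothing else**: v5′ was cut from the v4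
base by mistake, so its §6 silently REVERTED to the v4 PLACEHOLDER tables (`Γc = 1830`, `Ccc = 15`, placeholder `ιc`/`Pdc`/`cRc`, budget `1845 ≤ 3540`) and lost
v5's S-2′ docstring (A26-13) and the N3 numbering — while the registered stub texts `stub_S3_cone : ConeP (EntryBoundsW 8 K₀c) ρc ιc Pdc cRc Γc Ccc` /
`stub_S2_matRep : MaterialRepresentation' (EntryBoundsW 8 K₀c) ηc Bc ιc Pdc cRc` are byte-identical in v4/v5/v5′/v6 (they name the tables, whose DEFINITIONS
differ).  v6 therefore carries: the v5 §6 TABLES OF RECORD (below), `target_of_S4'` DELETED (v5′: `Target_holds` is the UNIQUE decl whose type is the Target —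
the skeleton checker takes the first one), and the S-2′ docstring amended per arbiter A27-1 (i)/A27-1′ (F-k1loc-9 NOT fired; far-H column feed bounded;
tail `s ≥ 10` pending v2 = A27-2).  The registered stub names and signatures are unchanged, so re-running `ledger skeleton check … --crux
stmt-AnomalousDissipation-20024` on v6 is a re-registration of the same two stubs over the tables of record.  v5 (prover ad-k1loc-p3 g8) = v4 (21c49f01f2f5,
VETTED-v4 by planner ad-ideate-p4 g18 04:32Z) with (i) §6 tables `ιc`/`Pdc`/`cRc`/`Γc`/`Ccc` := memo `K2AssemblyS4-vet-p4g18.md` v1.2 §9.5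
VERBATIM (the R-b far-lineage book: `ι n (t, s ≥ 5) := 0` is a STRUCTURAL zero — far-born comb progeny is lineage, read out through `cR n` — no hard
cut-off; tails are laws: `Pd` far H `80·(71/100)^(s-8)`, `cRc n = 678·13^(n-1)`), `BudgetP_holds` re-proved (`1·730 + 76/5 = 745.2 ≤ (5·11.9)² = 3540.25`,
room ×4.75; `(1+1/10)·268/5 = 58.96 ≤ 59.5`); (ii) S-2′ docstring per A26-13 (2a)/(2b)/(3): lineage set, the K-uniform read-out law, the named open laws
E6 (far-block one-phase gain `g ≤ 40` of record, tables at `g = 13`) and **SPK = F-k1loc-9** (THE open law; kill criterion WO-p4-K2-8); (iii) N3: section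
numbering made unique (§0.1–§0.8, §1–§6).  Unchanged and VERBATIM from v4: §0 (= `K2ConeSketch.lean` v1.3 §§1–6 incl. `RenewalConeInvariant`), §1 `GenBook`/`ConeP`/
`BudgetP`/`GenBook.readout_le` (companion `K2AssemblyS4_vet_p4g18.lean` §1), §2 `K2GrowthCtgPointH` (SHAPE Q v2) and `Idx`, §3 `EntryBoundsW`,
`renewalConeInvariant_of_coneP`, §4 `MatRepAt'`/`MaterialRepresentation'`, §5 `k2PhaseGrowthClassicalH_of_matRep'`/`K2GrowthCtgPointH_of'`,
§6 `ρc = 268/5`, `ηc = 1/10`, `K₀c = 24`, `Bc = 1`, the two stubs `stub_S3_cone : ConeP (EntryBoundsW 8 K₀c) ρc ιc Pdc cRc Γc Ccc`,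
`stub_S2_matRep : MaterialRepresentation' (EntryBoundsW 8 K₀c) ηc Bc ιc Pdc cRc` (THE ONLY TWO SORRIES), `exp_eight_sawSigmaStar_ge'`, `K2GrowthCtgPointH_holds`,
**`Target_holds : Theses.SawtoothPulseCascade.Target := Theorems.SawtoothPulseCascade.target_of_K2GrowthCtgPointH (K2GrowthCtgPointH_of' stub_S3_cone
stub_S2_matRep BudgetP_holds)`** (literal; the ONLY decl whose type is the Target).
REGISTRATION (A26-13 (4) / A26-14): registered on stmt-AnomalousDissipation-20024 since v5′ (05:43Z/05:44Z); v6 re-runs the check verbatim (same stubs).  WHAT THIS IS NOT: no entry bounded, no certificate (the tables are law-completed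
double-precision engine maxima, memo §9.6), no identification proved; 19491/19696/20024 open; AD not claimed.
-/
set_option linter.dupNamespace false
set_option linter.unusedVariables false

noncomputable section

namespace Summit.AnomalousDissipation.AnomalousDissipation.Cruxes.K1LocalisedCascade.K2S4

open Complex MeasureTheory intervalIntegral Finset
open Literature.Analysis Literature.Analysis.FunctionSpaces Literature.Analysis.FluidPDE
open Literature.Analysis.FluidPDE.SawtoothCascade

/-! ## 0. The one-family objects of `K2TypedSlotMap.lean` (g15, commit 5cbecd5f08b7), reproduced (kernel sign as fixed by p2)

(`Cruxes/…` workfiles are not importable modules on the farm — `lean check` reports the import as unbuilt — so §1–§3 of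
that file are copied here unchanged except for the ONE-CHARACTER kernel sign fix of p2's `K2SlotMapIdentities.lean` (see
`lineKernel`); the names agree, the namespace differs.) -/

section SlotMapCopy

/-! ### 0.1 Kernel, transport phase, Kelvin–Helmholtz block, explicit propagator -/

/-- The periodised Biot–Savart LINE KERNEL of the family with streamwise wavenumber `a` and transverse Bloch
phase `β`: `G_{a,β}(y) = Σ_{n∈ℤ} e^{2πiβn} g(y - n)`, `g(y) = -e^{-κ|y|}/(2κ)`, `κ = 2π|a|`, in closed form on
`y = ⌊y⌋ + r`: `e^{2πiβ⌊y⌋} · (-(e^{-κr}/(1 - e^{-2πiβ}e^{-κ}) + e^{κ(r-1)} e^{2πiβ}/(1 - e^{2πiβ}e^{-κ}))/(2κ))`.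
(`-G_{a,β}(y₀ - y)` is the stream function at height `y₀` of the unit vorticity mode `e^{2πiax} δ(· - y)`;
junk at `a = 0`, where it is only ever multiplied by `a`.)  SIGN: this is p2's CORRECTED term (`K2SlotMapIdentities.lean`, prover
ad-k1loc-p2 g9: in g15's file the leading `-` bound only the first lattice branch; with the bracket fixed `KernelAtZero`/`KernelAtHalf`/
`BlockSq`/`PropagatorODE` are proved there from tree theorems p684501/p684727).  The kit engines of this memo (`Gfun` of `wo_p4_k2_4.py`,
g15's 3h engine) compute `-s/(2κ)` with `s` = the SUM of both branches, i.e. the corrected sign, so no number is affected. -/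
def lineKernel (a β y : ℝ) : ℂ :=
  let κ : ℝ := 2 * Real.pi * |a|
  let r : ℝ := y - (⌊y⌋ : ℝ)
  let z : ℂ := Complex.exp (2 * Real.pi * β * Complex.I)
  Complex.exp (2 * Real.pi * β * (⌊y⌋ : ℝ) * Complex.I) *
    ((-(((Real.exp (-(κ * r)) : ℂ) / (1 - (starRingEnd ℂ z) * (Real.exp (-κ) : ℂ)))
          + (Real.exp (κ * (r - 1)) : ℂ) * z / (1 - z * (Real.exp (-κ) : ℂ)))) / (2 * κ : ℂ))

/-- Transport multiplier of an H slot of total strain `θ` on the streamwise mode `a`: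
`e^{2πiax} ζ₀(y) ↦ e^{2πia(x - θ·triWave y)} ζ₀(y)`. -/
def transportPhase (a θ y : ℝ) : ℂ :=
  Complex.exp (-(2 * Real.pi * a * θ * triWave y : ℝ) * Complex.I)

/-- The 2 × 2 Kelvin–Helmholtz block of the kink-sheet pair `(q₊ on y = 1/4, q₋ on y = -1/4)`:
`X = 2πia · [[-1/4 - 2G(0), -2G(1/2)], [2 conj G(1/2), 1/4 + 2G(0)]]`, `G = lineKernel a β`
(diagonal = transport of each sheet by the shear at its own line ± self/partner induction; the tree's
`khField k β` is `X` with `2πG(0) = Σ₀`, `2π conj G(1/2) = S`). -/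
def blockX (a β : ℝ) : Matrix (Fin 2) (Fin 2) ℂ :=
  ((2 * Real.pi * a : ℝ) * Complex.I : ℂ) •
    !![-(1 / 4 : ℂ) - 2 * lineKernel a β 0, -2 * lineKernel a β (1 / 2);
       2 * starRingEnd ℂ (lineKernel a β (1 / 2)), (1 / 4 : ℂ) + 2 * lineKernel a β 0]

/-- `λ(a, β) = -a²·c²(a, β)`: the common eigenvalue-square of the block, `X² = λ • 1` (`BlockSq`);
`λ > 0` unstable (rate `√λ = sawSigma a β`), `λ < 0` stable, `λ = 0` neutral. -/
def khLam (a β : ℝ) : ℝ := -(a ^ 2 * sawC2 a β)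

/-- `C(t)`: `cosh(√λ t)` / `cos(√(-λ) t)` / `1`. -/
def propC (a β t : ℝ) : ℝ :=
  if 0 < khLam a β then Real.cosh (Real.sqrt (khLam a β) * t)
  else if khLam a β < 0 then Real.cos (Real.sqrt (-(khLam a β)) * t) else 1

/-- `Sn(t)`: `sinh(√λ t)/√λ` / `sin(√(-λ) t)/√(-λ)` / `t`. -/
def propSn (a β t : ℝ) : ℝ :=
  if 0 < khLam a β then Real.sinh (Real.sqrt (khLam a β) * t) / Real.sqrt (khLam a β)
  else if khLam a β < 0 then Real.sin (Real.sqrt (-(khLam a β)) * t) / Real.sqrt (-(khLam a β)) else t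

/-- The explicit propagator `P(t) = e^{tX} = C(t)·1 + Sn(t)·X` (p2 `sheet_solution_eq`; `det P = 1`). -/
def propagator (a β t : ℝ) : Matrix (Fin 2) (Fin 2) ℂ :=
  ((propC a β t : ℝ) : ℂ) • (1 : Matrix (Fin 2) (Fin 2) ℂ) + ((propSn a β t : ℝ) : ℂ) • blockX a β

/-! ### 0.2 Lamination states, forcing, Duhamel, the slot map -/

/-- S-4 state of ONE line family: an interior density profile on the period `[-1/2, 1/2)` (quasi-periodic
continuation with Bloch phase `β` understood) plus finitely many vortex SHEETS `(position yᵢ ∈ [-1/2,1/2),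
amplitude cᵢ)`, i.e. the transverse density `ζ₀(y) + Σᵢ cᵢ δ(y - yᵢ)` of the streamwise mode `e^{2πiax}`. -/
structure LamState where
  interior : ℝ → ℂ
  sheets : List (ℝ × ℂ)

/-- The pure interior mode `ζ₀ ≡ 1` (the transverse mode `n = 0` when `β = 0`): the comb remnant of P3. -/
def pureMode : LamState := ⟨fun _ => 1, []⟩

/-- A bare sheet pair on the kink lines with amplitudes `(q₊, q₋)` and no interior content. -/
def sheetPair (qp qm : ℂ) : LamState := ⟨fun _ => 0, [((1 / 4 : ℝ), qp), (-(1 / 4 : ℝ), qm)]⟩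

/-- Forcing of the block at slot-time `s`: `f(s) = 2πia · (-2 ∫ G(1/4 - y) dμ_s(y), 2 ∫ G(-1/4 - y) dμ_s(y))`
where `μ_s = transported state = (ζ₀(y) dy + Σ cᵢ δ_{yᵢ}) · e^{-2πias·triWave y}` — the transverse velocity the
transported content induces on the two kink lines, times the vorticity jump. -/
def forcing (a β : ℝ) (st : LamState) (s : ℝ) : Fin 2 → ℂ :=
  let src : ℝ → ℂ := fun y0 =>
    (∫ y in (-(1 / 2 : ℝ))..(1 / 2), lineKernel a β (y0 - y) * st.interior y * transportPhase a s y)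
      + (st.sheets.map (fun p => lineKernel a β (y0 - p.1) * p.2 * transportPhase a s p.1)).sum
  ![((2 * Real.pi * a : ℝ) * Complex.I : ℂ) * (-2) * src (1 / 4),
    ((2 * Real.pi * a : ℝ) * Complex.I : ℂ) * 2 * src (-(1 / 4))]

/-- Fresh sheet amplitudes after strain `θ` (Duhamel): `q(θ) = ∫₀^θ P(θ - s) f(s) ds`. -/
def sheetAmps (a β θ : ℝ) (st : LamState) : Fin 2 → ℂ :=
  ∫ s in (0 : ℝ)..θ, (propagator a β (θ - s)).mulVec (forcing a β st s)

/-- THE SLOT MAP on one line family (S-2): transported interior, transported old sheets, plus the fresh pair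
`(1/4, q₊), (-1/4, q₋)`. -/
def slotMap (a β θ : ℝ) (st : LamState) : LamState :=
  ⟨fun y => st.interior y * transportPhase a θ y,
   (st.sheets.map (fun p => (p.1, p.2 * transportPhase a θ p.1)))
     ++ [((1 / 4 : ℝ), sheetAmps a β θ st 0), (-(1 / 4 : ℝ), sheetAmps a β θ st 1)]⟩

/-! ### 0.3 Fourier coefficients and energy -/

/-- Transverse Fourier coefficient at `β + n`: `ζ̂(n) = ∫ ζ₀ e^{-2πi(β+n)y} dy + Σᵢ cᵢ e^{-2πi(β+n)yᵢ}`. -/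
def coeff (β : ℝ) (st : LamState) (n : ℤ) : ℂ :=
  (∫ y in (-(1 / 2 : ℝ))..(1 / 2), st.interior y * Complex.exp (-(2 * Real.pi * (β + n) * y : ℝ) * Complex.I))
    + (st.sheets.map (fun p => p.2 * Complex.exp (-(2 * Real.pi * (β + n) * p.1 : ℝ) * Complex.I))).sum

/-- Kinetic energy (velocity `L²` norm squared, up to the common factor) of the state on the family `(a, β)`:
`E = Σ_n |ζ̂(n)|² / (4π² (a² + (β + n)²))` (junk 0 if not summable; summable whenever the interior is
integrable, the coefficients being bounded and the weights `O(n⁻²)`). -/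
def energy (a β : ℝ) (st : LamState) : ℝ :=
  ∑' n : ℤ, ‖coeff β st n‖ ^ 2 / (4 * Real.pi ^ 2 * (a ^ 2 + (β + n) ^ 2))


end SlotMapCopy

/-! ### 0.4 Truncated class states, energy, children -/

/-- Lattice state of one Bloch class `(α, β)`: the vorticity Fourier coefficient at wavevector `(α + m, β + n)`. -/
abbrev CState : Type := ℤ → ℤ → ℂ

/-- The truncation window `[-K, K]`. -/
def win (K : ℕ) : Finset ℤ := Finset.Icc (-(K : ℤ)) K

/-- Kinetic energy at level `ℓ` (wavenumbers scaled by `2^ℓ`) of the truncated state: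
`Σ_{|m|,|n| ≤ K} |ζ(m,n)|² / (4π² 4^ℓ ((α+m)² + (β+n)²))` (the zero mode, if present, contributes 0: `x / 0 = 0`). -/
def cEnergy (α β : ℝ) (ℓ K : ℕ) (ζ : CState) : ℝ :=
  ∑ m ∈ win K, ∑ n ∈ win K, ‖ζ m n‖ ^ 2 / (4 * Real.pi ^ 2 * (4 : ℝ) ^ ℓ * ((α + m) ^ 2 + (β + n) ^ 2))

/-- CHILDREN re-framing (one cascade level down, period halves): the modes of class `(α, β)` with parities `(pm, pn)`
form the child class `((α + pm)/2, (β + pn)/2)` with `ζ_child(m, n) = ζ(2m + pm, 2n + pn)`. -/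
def child (pm pn : ℤ) (ζ : CState) : CState := fun m n => ζ (2 * m + pm) (2 * n + pn)

/-- The child class of `(α, β)` with parities `(pm, pn)`. -/
def childClass (α β : ℝ) (pm pn : ℤ) : ℝ × ℝ := ((α + pm) / 2, (β + pn) / 2)

/-- The parity set `{0, 1}`. -/
def parities : Finset ℤ := {0, 1}

/-! ### 0.5 The two slots of a phase, family by family -/

/-- The transverse profile `y ↦ Σ_{|n| ≤ K} c(n) e^{2πi(β+n)y}` of a truncated coefficient row. -/
def modeProfile (β : ℝ) (K : ℕ) (c : ℤ → ℂ) : ℝ → ℂ :=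
  fun y => ∑ n ∈ win K, c n * Complex.exp ((2 * Real.pi * (β + n) * y : ℝ) * Complex.I)

/-- H slot (strain `θ`), TRANSPORTED part: row `m` is the family `(α + m, β)`; its profile is multiplied by
`transportPhase` and re-expanded (`K2SlotMap.coeff`), truncated to the window. -/
def hTransport (α β θ : ℝ) (K : ℕ) (ζ : CState) : CState := fun m n' =>
  if m ∈ win K ∧ n' ∈ win K then
    coeff β ⟨fun y => modeProfile β K (ζ m) y * transportPhase (α + m) θ y, []⟩ n'
  else 0

/-- H slot, FRESH H-pair densities per row (`K2SlotMap.sheetAmps` of the row's family): `q m = (q₊, q₋)` on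
`y = 1/4`, `y = -1/4`, streamwise wavenumber `α + m`. -/
def hFresh (α β θ : ℝ) (K : ℕ) (ζ : CState) : ℤ → Fin 2 → ℂ := fun m =>
  if m ∈ win K then sheetAmps (α + m) β θ ⟨modeProfile β K (ζ m), []⟩ else 0

/-- Lattice state of an H-sheet pair with densities `q` (engine `SH`): `Z(m,n) = q₊(m) e^{-iπ(β+n)/2} + q₋(m) e^{iπ(β+n)/2}`. -/
def hPairState (β : ℝ) (q : ℤ → Fin 2 → ℂ) : CState := fun m n =>
  q m 0 * Complex.exp (-(Real.pi * (β + n) / 2 : ℝ) * Complex.I)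
    + q m 1 * Complex.exp ((Real.pi * (β + n) / 2 : ℝ) * Complex.I)

/-- V slot (strain `θ`), TRANSPORTED part: column `n` is the family `(β + n, α)` (roles of the coordinates exchanged),
its profile over `x` read from the column. -/
def vTransport (α β θ : ℝ) (K : ℕ) (ζ : CState) : CState := fun m' n =>
  if m' ∈ win K ∧ n ∈ win K then
    coeff α ⟨fun x => modeProfile α K (fun m => ζ m n) x * transportPhase (β + n) θ x, []⟩ m'
  else 0

/-- V slot, FRESH V-pair densities per column: `p n = (p₊, p₋)` on `x = 1/4`, `x = -1/4`, streamwise wavenumber `β + n`. -/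
def vFresh (α β θ : ℝ) (K : ℕ) (ζ : CState) : ℤ → Fin 2 → ℂ := fun n =>
  if n ∈ win K then sheetAmps (β + n) α θ ⟨modeProfile α K (fun m => ζ m n), []⟩ else 0

/-- Lattice state of a V-sheet pair with densities `p` (engine `SV`): `Z(m,n) = p₊(n) e^{-iπ(α+m)/2} + p₋(n) e^{iπ(α+m)/2}`. -/
def vPairState (α : ℝ) (p : ℤ → Fin 2 → ℂ) : CState := fun m n =>
  p n 0 * Complex.exp (-(Real.pi * (α + m) / 2 : ℝ) * Complex.I)
    + p n 1 * Complex.exp ((Real.pi * (α + m) / 2 : ℝ) * Complex.I)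

/-! ### 0.6 Phase pieces (material bookkeeping of one phase = H slot then V slot at one level) -/

/-- The three pieces a phase produces from the state entering it. -/
structure PhasePieces where
  /-- densities of the fresh straight V-pair created in the V slot (type V). -/
  freshV : ℤ → Fin 2 → ℂ
  /-- densities of the fresh H-pair created in the H slot; at phase end its state is `vTransport (hPairState freshH)` (type H). -/
  freshH : ℤ → Fin 2 → ℂ
  /-- debris: the entering state transported by both slots. -/
  debris : CState

/-- The phase pieces of class `(α, β)` at truncation `K` (strain `θ` per slot): `T = hTransport ζ`, `hq = hFresh ζ`,
the V slot acts on `T + hPairState hq`; fresh V densities from the whole of it, debris = `vTransport T`. -/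
def phasePieces (α β θ : ℝ) (K : ℕ) (ζ : CState) : PhasePieces :=
  let T : CState := hTransport α β θ K ζ
  let hq : ℤ → Fin 2 → ℂ := hFresh α β θ K ζ
  let S : CState := fun m n => T m n + hPairState β hq m n
  ⟨vFresh α β θ K S, hq, vTransport α β θ K T⟩

/-- The total state at phase end: fresh V pair + V-transported fresh H pair + debris. -/
def phaseTotal (α β θ : ℝ) (K : ℕ) (ζ : CState) : CState := fun m n =>
  let pc := phasePieces α β θ K ζ
  vPairState α pc.freshV m n + vTransport α β θ K (hPairState β pc.freshH) m n + pc.debris m n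

/-! ### 0.7 Shells and the shell-transfer entries -/

/-- Lower edges of the shells of `|streamwise wavenumber|` of a sheet density: `S0 = [0, 0.64)` (KH band),
`S1 = [0.64, 2)`, `S(s) = [2^(s-1), 2^s)` for `s ≥ 2`. -/
def shellLo : ℕ → ℝ
  | 0 => 0
  | 1 => 16 / 25
  | (s + 2) => (2 : ℝ) ^ (s + 1)

/-- Upper edge of shell `s`. -/
def shellHi (s : ℕ) : ℝ := shellLo (s + 1)

/-- `x` lies in shell `s`. -/
def InShell (s : ℕ) (x : ℝ) : Prop := shellLo s ≤ |x| ∧ |x| < shellHi s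

/-- The two piece types carrying a shell profile: fresh straight V pairs and once-transported H pairs. -/
inductive PType
  | V
  | H
  deriving DecidableEq, Fintype

/-- Densities restricted to shell `s` (offset `c` = the class coordinate along the sheet). -/
def restrictShell (s : ℕ) (c : ℝ) (d : ℤ → Fin 2 → ℂ) : ℤ → Fin 2 → ℂ :=
  fun (k : ℤ) => if shellLo s ≤ |c + (k : ℝ)| ∧ |c + (k : ℝ)| < shellHi s then d k else 0

/-- "the densities `d` are supported in shell `s`". -/
def SupportedIn (s : ℕ) (c : ℝ) (d : ℤ → Fin 2 → ℂ) : Prop := ∀ k : ℤ, ¬ InShell s (c + (k : ℝ)) → d k = 0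

/-- v1.3: "the densities `d` are supported in shell `s` AND in the truncation window `|k| ≤ K`" (the engine's input basis). -/
def SupportedInW (s : ℕ) (c : ℝ) (K : ℕ) (d : ℤ → Fin 2 → ℂ) : Prop :=
  SupportedIn s c d ∧ ∀ k : ℤ, k ∉ win K → d k = 0

/-- v1.3: truncation of a class state to the window `|m|, |n| ≤ K` (the engine's `(2K+1)²` arrays). -/
def truncW (K : ℕ) (ζ : CState) : CState :=
  fun (m n : ℤ) => if m ∈ win K ∧ n ∈ win K then ζ m n else 0

/-- The lattice state, at phase ENTRY (class `(α, β)`, level 0), of an input piece of type `t` with densities `d`: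
a straight V pair (v1.3: window-truncated, as the engine's `SV` on the `(2K+1)²` lattice), resp. an H pair V-transported once
(created in the previous H slot of the same level; `vTransport` is windowed already). -/
def inputState (α β θ : ℝ) (K : ℕ) : PType → (ℤ → Fin 2 → ℂ) → CState
  | PType.V, p => truncW K (vPairState α p)
  | PType.H, q => vTransport α β θ K (hPairState β q)

/-- The class coordinate along the sheets of type `t`: `β` for V pairs (densities in `β + n`), `α` for H pairs. -/
def alongCoord (α β : ℝ) : PType → ℝ
  | PType.V => β
  | PType.H => α

/-- Level-`ℓ` energy of the output piece `(t', s')` among the phase pieces `pc` of a class `(α', β')` sitting at level `ℓ`. -/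
def outEnergyAt (α' β' θ : ℝ) (K ℓ : ℕ) (s' : ℕ) (pc : PhasePieces) : PType → ℝ
  | PType.V => cEnergy α' β' ℓ K (vPairState α' (restrictShell s' β' pc.freshV))
  | PType.H => cEnergy α' β' ℓ K (vTransport α' β' θ K (hPairState β' (restrictShell s' α' pc.freshH)))

/-- Level-1 energy of the output piece `(t', s')` among the phase pieces `pc` of the child class `(α', β')`. -/
def outEnergy (α' β' θ : ℝ) (K : ℕ) (s' : ℕ) (pc : PhasePieces) : PType → ℝ :=
  outEnergyAt α' β' θ K 1 s' pc

/-- SHELL-TRANSFER ENTRY `M[(t', s'), (t, s)] ≤ M` for the parent class `(α, β)` at truncation `K`: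
every input piece of type `t` with densities in shell `s` produces, summed over the four children and after their
phase, an output piece `(t', s')` of level-1 energy ≤ `M²` × its own level-0 energy.  (WO-p4-K2-4 computes the sup.) -/
def Transfer (α β θ : ℝ) (K : ℕ) (t : PType) (s : ℕ) (t' : PType) (s' : ℕ) (M : ℝ) : Prop :=
  ∀ d : ℤ → Fin 2 → ℂ, SupportedInW s (alongCoord α β t) K d →
    (∑ pm ∈ parities, ∑ pn ∈ parities,
        outEnergy ((α + pm) / 2) ((β + pn) / 2) θ K s'
          (phasePieces ((α + pm) / 2) ((β + pn) / 2) θ K (child pm pn (inputState α β θ K t d))) t')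
      ≤ M ^ 2 * cEnergy α β 0 K (inputState α β θ K t d)

/-- DEBRIS column `m_O[(t, s)] ≤ mO`: the twice-transported remainder produced from an input piece `(t, s)`. -/
def DebrisCreation (α β θ : ℝ) (K : ℕ) (t : PType) (s : ℕ) (mO : ℝ) : Prop :=
  ∀ d : ℤ → Fin 2 → ℂ, SupportedInW s (alongCoord α β t) K d →
    (∑ pm ∈ parities, ∑ pn ∈ parities,
        cEnergy ((α + pm) / 2) ((β + pn) / 2) 1 K
          (phasePieces ((α + pm) / 2) ((β + pn) / 2) θ K (child pm pn (inputState α β θ K t d))).debris)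
      ≤ mO ^ 2 * cEnergy α β 0 K (inputState α β θ K t d)

/-- DEBRIS LINEAGE OUTPUT.  `debrisOut θ K t' s' k ℓ α β ζ` = the energy, at level `ℓ + k + 1` and summed over all
`4^(k+1)` descendant classes, of the output piece `(t', s')` produced by content `ζ` of class `(α, β)` (level `ℓ`) that
travels the DEBRIS path (children ↦ transported by both slots) for `k` phases and then passes one full phase;
`k = 0` is the quantity bounded in `Transfer`.  (WO-p4-K2-4b, `wo_p4_k2_4b.py`, measures the sups for ages `k ≤ 3`.) -/
def debrisOut (θ : ℝ) (K : ℕ) (t' : PType) (s' : ℕ) : ℕ → ℕ → ℝ → ℝ → CState → ℝ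
  | 0, ℓ, α, β, ζ => ∑ pm ∈ parities, ∑ pn ∈ parities,
      outEnergyAt ((α + pm) / 2) ((β + pn) / 2) θ K (ℓ + 1) s'
        (phasePieces ((α + pm) / 2) ((β + pn) / 2) θ K (child pm pn ζ)) t'
  | (k + 1), ℓ, α, β, ζ => ∑ pm ∈ parities, ∑ pn ∈ parities,
      debrisOut θ K t' s' k (ℓ + 1) ((α + pm) / 2) ((β + pn) / 2)
        (phasePieces ((α + pm) / 2) ((β + pn) / 2) θ K (child pm pn ζ)).debris

/-- RENEWAL (DEBRIS-TRANSFER) ENTRY of age `k ≥ 1`: `D_k[(t', s'), (t, s)] ≤ D` for the parent class `(α, β)` —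
the age-`k` debris of an input piece `(t, s)` produces output pieces `(t', s')` of energy ≤ `D²` × the input energy.
No decay in `k` is asked for (the data show persistence, `O→O ≈ 1`, for KH-band debris): the renewal cone below only
needs the entries bounded, uniformly in the age. -/
def DebrisTransfer (α β θ : ℝ) (K k : ℕ) (t : PType) (s : ℕ) (t' : PType) (s' : ℕ) (D : ℝ) : Prop :=
  ∀ d : ℤ → Fin 2 → ℂ, SupportedInW s (alongCoord α β t) K d →
    debrisOut θ K t' s' k 0 α β (inputState α β θ K t d) ≤ D ^ 2 * cEnergy α β 0 K (inputState α β θ K t d)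

/-! ### 0.8 The renewal cone of `K2ConeSketch.lean` §6 (v1.3 verbatim) -/

/-- **THE RENEWAL CONE** (the complete K-uniform bookkeeping statement: fresh transfer + debris of every age, no
decay assumed).  Profile `ε > 0` on (type, shell) — ALL shells, so that every truncation is covered — a fresh-transfer
matrix `M`, renewal matrices `D k` (`k ≥ 1`) and a rate `ρ` such that, uniformly in `K ≥ K₀` and the class: the entries
bound `Transfer` / `DebrisTransfer`, only finitely many columns are inhabited at each truncation (so all sums below are
finite sums in disguise), and the RENEWAL CONE inequality `M ε + Σ_{k≥1} ρ^{-k} D_k ε ≤ ρ ε` holds for all partial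
sums.  By `renewal_gauge` + `norm_sum_le_of_profile` this yields `E_L^{1/2} ≤ ρ^L · g · Σε`, i.e. the envelope of
`K2PhaseGrowthClassicalH` with constant `ρ e^{-8σ⋆}` (target: `ρ < 59.62`; measured main part `Λ ≤ 23.7` per class,
`≤ 32.6` class-uniform, renewal correction `D/(ρ-1) < 1`). -/
def RenewalConeInvariant (θ ρ : ℝ) (K₀ : ℕ) : Prop :=
  ∃ ε : PType × ℕ → ℝ, (∀ i, 0 < ε i) ∧
    ∃ (M : (PType × ℕ) → (PType × ℕ) → ℝ) (D : ℕ → (PType × ℕ) → (PType × ℕ) → ℝ),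
      (∀ i j, 0 ≤ M i j) ∧ (∀ k i j, 0 ≤ D k i j) ∧
      (∀ K : ℕ, K₀ ≤ K → ∀ α β : ℝ, α ∈ Set.Ico (0 : ℝ) 1 → β ∈ Set.Ico (0 : ℝ) 1 →
        ∀ i j : PType × ℕ, Transfer α β θ K j.1 j.2 i.1 i.2 (M i j) ∧
          ∀ k : ℕ, 1 ≤ k → DebrisTransfer α β θ K k j.1 j.2 i.1 i.2 (D k i j)) ∧
      (∀ (S : Finset (PType × ℕ)) (n : ℕ) (i : PType × ℕ),
        (∑ j ∈ S, M i j * ε j) + (∑ k ∈ Finset.range n, (ρ ^ (k + 1))⁻¹ * ∑ j ∈ S, D (k + 1) i j * ε j) ≤ ρ * ε i)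

/-! # §A — planner ad-ideate-p4 g18's companion `K2AssemblyS4_vet_p4g18.lean` §1, VERBATIM -/

/-! ## 1. Abstract generation bookkeeping at one read-out time -/

section Algebra

variable {Idx : Type*}

/-- **GENERATION BOOKKEEPING** (the algebraic content of `MatRepAt′` at one time `t` of phase `j₀+1+n`, input energy `E₀`, energy `Et` at `t`):
generation amplitudes `x m i ≥ 0` with (R0) `x 0 ≤ ι 0 • √E₀`; (R1η) for EVERY admissible nonnegative `(M, D)` and every `c` bounding all finite
partial sums of `Σ_j M i j x m j + Σ_{k<m} Σ_j D (k+1) i j x (m-k-1) j`: `x (m+1) i ≤ (1+η) c + ι (m+1) i √E₀`; (R2′) for every `c` bounding all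
finite partial sums of `Σ_{k≤n} Σ_i Pd k i x (n-k) i`: `√Et ≤ B c + cR n √E₀`. -/
def GenBook (Adm : (Idx → Idx → ℝ) → (ℕ → Idx → Idx → ℝ) → Prop) (η B : ℝ) (ι : ℕ → Idx → ℝ) (Pd : ℕ → Idx → ℝ)
    (cR : ℕ → ℝ) (n : ℕ) (E₀ Et : ℝ) : Prop :=
  ∃ x : ℕ → Idx → ℝ, (∀ m i, 0 ≤ x m i) ∧ (∀ i, x 0 i ≤ ι 0 i * Real.sqrt E₀) ∧
    (∀ (M : Idx → Idx → ℝ) (D : ℕ → Idx → Idx → ℝ), (∀ i j, 0 ≤ M i j) → (∀ k i j, 0 ≤ D k i j) → Adm M D →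
      ∀ (m : ℕ) (i : Idx) (c : ℝ),
        (∀ S : Finset Idx, (∑ j ∈ S, M i j * x m j) +
            (∑ k ∈ Finset.range m, ∑ j ∈ S, D (k + 1) i j * x (m - (k + 1)) j) ≤ c) →
        x (m + 1) i ≤ (1 + η) * c + ι (m + 1) i * Real.sqrt E₀) ∧
    (∀ c : ℝ, (∀ S : Finset Idx, (∑ k ∈ Finset.range (n + 1), ∑ i ∈ S, Pd k i * x (n - k) i) ≤ c) →
      Real.sqrt Et ≤ B * c + cR n * Real.sqrt E₀)

/-- **CONE WITH PROFILE DATA** (S3 as the reshaped assembly consumes it): positive profile `ε`, admissible nonnegative `(M, D)`, p4's renewal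
cone clause verbatim, and the profile costs of the comb feed `ι`, the debris read-out weights `Pd ≥ 0` and the comb remnant read-out `cR`. -/
def ConeP (Adm : (Idx → Idx → ℝ) → (ℕ → Idx → Idx → ℝ) → Prop) (ρ : ℝ) (ι : ℕ → Idx → ℝ) (Pd : ℕ → Idx → ℝ) (cR : ℕ → ℝ)
    (Γ Cc : ℝ) : Prop :=
  ∃ ε : Idx → ℝ, (∀ i, 0 < ε i) ∧
    ∃ (M : Idx → Idx → ℝ) (D : ℕ → Idx → Idx → ℝ), (∀ i j, 0 ≤ M i j) ∧ (∀ k i j, 0 ≤ D k i j) ∧ Adm M D ∧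
      (∀ (S : Finset Idx) (n : ℕ) (i : Idx),
        (∑ j ∈ S, M i j * ε j) + (∑ k ∈ Finset.range n, (ρ ^ (k + 1))⁻¹ * ∑ j ∈ S, D (k + 1) i j * ε j) ≤ ρ * ε i) ∧
      ∃ κ ϖ : ℕ → ℝ, (∀ m, 0 ≤ κ m) ∧ (∀ m i, ι m i ≤ κ m * ε i) ∧ (∀ k i, 0 ≤ Pd k i) ∧
        (∀ (k : ℕ) (S : Finset Idx), (∑ i ∈ S, Pd k i * ε i) ≤ ϖ k) ∧
        (∀ n : ℕ, (∑ m ∈ Finset.range (n + 1), κ m * (ρ ^ m)⁻¹) * (∑ k ∈ Finset.range (n + 1), ϖ k * (ρ ^ k)⁻¹) ≤ Γ) ∧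
        (∀ n : ℕ, 0 ≤ cR n ∧ cR n ≤ Cc * ρ ^ n)

/-- **BUDGET**: one cap factor per transfer phase INCLUDING the slack, `(1+η)ρ ≤ 5e^{8σ⋆}`, and the two spare cap factors pay the read-out ×
the discounted profile costs plus the comb remnant: `B Γ + Cc ≤ (5e^{8σ⋆})²`. -/
def BudgetP (ρ η B Γ Cc : ℝ) : Prop :=
  0 < ρ ∧ 0 ≤ η ∧ 0 ≤ B ∧ 0 ≤ Cc ∧ (1 + η) * ρ ≤ 5 * Real.exp (sawSigmaStar * 8) ∧
    B * Γ + Cc ≤ (5 * Real.exp (sawSigmaStar * 8)) ^ 2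

/-- Discounting lemma: `r^(m-k) ≤ r^m (ρ^k)⁻¹` for `0 < ρ ≤ r`, `k ≤ m`. -/
private theorem pow_sub_le_mul_inv {ρ r : ℝ} (hρ : 0 < ρ) (hρr : ρ ≤ r) {m k : ℕ} (hk : k ≤ m) :
    r ^ (m - k) ≤ r ^ m * (ρ ^ k)⁻¹ := by
  have hr : 0 < r := hρ.trans_le hρr
  have h1 : r ^ m = r ^ (m - k) * r ^ k := by rw [← pow_add, Nat.sub_add_cancel hk]
  rw [h1, mul_assoc]
  have h2 : 1 ≤ r ^ k * (ρ ^ k)⁻¹ := by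
    rw [← div_eq_mul_inv, one_le_div (pow_pos hρ k)]
    exact pow_le_pow_left₀ hρ.le hρr k
  calc r ^ (m - k) = r ^ (m - k) * 1 := (mul_one _).symm
    _ ≤ r ^ (m - k) * (r ^ k * (ρ ^ k)⁻¹) := mul_le_mul_of_nonneg_left h2 (pow_nonneg hr.le _)

/-- **THE ALGEBRAIC CORE OF THE RESHAPED ASSEMBLY.**  Bookkeeping + cone with profile data + budget ⇒ the read-out at phase `j₀+1+n` is under
`n+2` cap factors: `Et ≤ (5e^{8σ⋆})^{2(n+2)} E₀`.  Proof: with `r = (1+η)ρ` and `G m = √E₀ Σ_{l≤m} κ l r^{-l}` (nondecreasing), strong induction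
gives `x m i ≤ r^m G m ε i` (the cone row inequality bounds every partial sum in (R1η) by `r^m G m ρ ε i`, older generations being discounted by
`r^(m-k-1) ≤ r^m ρ^{-(k+1)}`); then (R2′) with `c = r^n G n Σ_{k≤n} ϖ k ρ^{-k}` and `G n ≤ √E₀ Σ κ ρ^{-l}`, `cR n ≤ Cc ρ^n ≤ Cc r^n`. -/
theorem GenBook.readout_le {Adm : (Idx → Idx → ℝ) → (ℕ → Idx → Idx → ℝ) → Prop} {η B ρ Γ Cc E₀ Et : ℝ}
    {ι : ℕ → Idx → ℝ} {Pd : ℕ → Idx → ℝ} {cR : ℕ → ℝ} {n : ℕ}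
    (hGB : GenBook Adm η B ι Pd cR n E₀ Et) (hC : ConeP Adm ρ ι Pd cR Γ Cc) (hb : BudgetP ρ η B Γ Cc)
    (hE₀ : 0 ≤ E₀) (hEt : 0 ≤ Et) :
    Et ≤ (5 * Real.exp (sawSigmaStar * 8)) ^ (2 * (n + 2)) * E₀ := by
  obtain ⟨x, hxnn, hx0, hstep, hread⟩ := hGB
  obtain ⟨ε, hε, M, D, hM, hD, hAdm, hcone, κ, ϖ, hκ, hικ, hPd, hϖ, hΓ, hcR⟩ := hC
  obtain ⟨hρ, hη, hB, hCc, hrL, hBL⟩ := hb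
  set L : ℝ := 5 * Real.exp (sawSigmaStar * 8) with hL
  set r : ℝ := (1 + η) * ρ with hr
  have hη1 : 1 ≤ 1 + η := by linarith
  have hρr : ρ ≤ r := by rw [hr]; nlinarith
  have hr0 : 0 < r := hρ.trans_le hρr
  have hsq0 : 0 ≤ Real.sqrt E₀ := Real.sqrt_nonneg _
  -- the gauge sequence
  set G : ℕ → ℝ := fun m => Real.sqrt E₀ * ∑ l ∈ Finset.range (m + 1), κ l * (r ^ l)⁻¹ with hG
  have hGterm : ∀ l, 0 ≤ κ l * (r ^ l)⁻¹ := fun l => mul_nonneg (hκ l) (inv_nonneg.mpr (pow_nonneg hr0.le l))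
  have hG0 : ∀ m, 0 ≤ G m := fun m => mul_nonneg hsq0 (Finset.sum_nonneg fun l _ => hGterm l)
  have hGmono : ∀ {l m : ℕ}, l ≤ m → G l ≤ G m := by
    intro l m hlm
    simp only [hG]
    refine mul_le_mul_of_nonneg_left ?_ hsq0
    exact Finset.sum_le_sum_of_subset_of_nonneg (Finset.range_mono (by omega)) fun i _ _ => hGterm i
  have hGsucc : ∀ m, G (m + 1) = G m + Real.sqrt E₀ * (κ (m + 1) * (r ^ (m + 1))⁻¹) := by
    intro m; simp only [hG]; rw [Finset.sum_range_succ, mul_add]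
  -- the envelope, by strong induction
  have henv : ∀ m, ∀ l, l ≤ m → ∀ i, x l i ≤ r ^ l * G l * ε i := by
    intro m
    induction m with
    | zero =>
      intro l hl i
      have hl0 : l = 0 := by omega
      subst hl0
      calc x 0 i ≤ ι 0 i * Real.sqrt E₀ := hx0 i
        _ ≤ (κ 0 * ε i) * Real.sqrt E₀ := mul_le_mul_of_nonneg_right (hικ 0 i) hsq0
        _ = r ^ 0 * G 0 * ε i := by simp only [hG]; simp; ring
    | succ m ih =>
      intro l hl i
      rcases Nat.lt_or_ge l (m + 1) with hlt | hge
      · exact ih l (by omega) i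
      · have hl : l = m + 1 := by omega
        subst hl
        -- bound every partial sum of (R1η) at generation m by `r^m G m ρ ε i`
        have hpart : ∀ S : Finset Idx, (∑ j ∈ S, M i j * x m j) +
            (∑ k ∈ Finset.range m, ∑ j ∈ S, D (k + 1) i j * x (m - (k + 1)) j) ≤ r ^ m * G m * (ρ * ε i) := by
          intro S
          have h1 : (∑ j ∈ S, M i j * x m j) ≤ ∑ j ∈ S, M i j * (r ^ m * G m * ε j) :=
            Finset.sum_le_sum fun j _ => mul_le_mul_of_nonneg_left (ih m le_rfl j) (hM i j)
          have h2 : (∑ k ∈ Finset.range m, ∑ j ∈ S, D (k + 1) i j * x (m - (k + 1)) j) ≤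
              ∑ k ∈ Finset.range m, ∑ j ∈ S, D (k + 1) i j * (r ^ m * G m * ((ρ ^ (k + 1))⁻¹ * ε j)) := by
            refine Finset.sum_le_sum fun k hk => Finset.sum_le_sum fun j _ => mul_le_mul_of_nonneg_left ?_ (hD _ i j)
            have hkm : k + 1 ≤ m := by simpa [Finset.mem_range] using hk
            calc x (m - (k + 1)) j ≤ r ^ (m - (k + 1)) * G (m - (k + 1)) * ε j := ih (m - (k + 1)) (by omega) j
              _ ≤ (r ^ m * (ρ ^ (k + 1))⁻¹) * G m * ε j :=
                  mul_le_mul_of_nonneg_right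
                    (mul_le_mul (pow_sub_le_mul_inv hρ hρr hkm) (hGmono (by omega)) (hG0 _)
                      (mul_nonneg (pow_nonneg hr0.le _) (inv_nonneg.mpr (pow_nonneg hρ.le _))))
                    (hε j).le
              _ = r ^ m * G m * ((ρ ^ (k + 1))⁻¹ * ε j) := by ring
          have h3 : (∑ j ∈ S, M i j * (r ^ m * G m * ε j)) +
              (∑ k ∈ Finset.range m, ∑ j ∈ S, D (k + 1) i j * (r ^ m * G m * ((ρ ^ (k + 1))⁻¹ * ε j))) =
              r ^ m * G m * ((∑ j ∈ S, M i j * ε j) +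
                ∑ k ∈ Finset.range m, (ρ ^ (k + 1))⁻¹ * ∑ j ∈ S, D (k + 1) i j * ε j) := by
            rw [mul_add, Finset.mul_sum, Finset.mul_sum]
            congr 1
            · exact Finset.sum_congr rfl fun j _ => by ring
            · refine Finset.sum_congr rfl fun k _ => ?_
              rw [Finset.mul_sum, Finset.mul_sum]
              exact Finset.sum_congr rfl fun j _ => by ring
          calc _ ≤ _ := add_le_add h1 h2
            _ = _ := h3
            _ ≤ r ^ m * G m * (ρ * ε i) :=
                mul_le_mul_of_nonneg_left (hcone S m i) (mul_nonneg (pow_nonneg hr0.le _) (hG0 _))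
        have hx1 := hstep M D hM hD hAdm m i (r ^ m * G m * (ρ * ε i)) hpart
        calc x (m + 1) i ≤ (1 + η) * (r ^ m * G m * (ρ * ε i)) + ι (m + 1) i * Real.sqrt E₀ := hx1
          _ ≤ (1 + η) * (r ^ m * G m * (ρ * ε i)) + (κ (m + 1) * ε i) * Real.sqrt E₀ :=
              add_le_add le_rfl (mul_le_mul_of_nonneg_right (hικ _ i) hsq0)
          _ = r ^ (m + 1) * G (m + 1) * ε i := by
              rw [hGsucc m]
              have h1 : r ^ (m + 1) * (r ^ (m + 1))⁻¹ = 1 := mul_inv_cancel₀ (pow_ne_zero _ hr0.ne')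
              have h2 : (1 + η) * (r ^ m * G m * (ρ * ε i)) = r ^ (m + 1) * G m * ε i := by
                rw [pow_succ, hr]; ring
              rw [h2]
              calc r ^ (m + 1) * G m * ε i + κ (m + 1) * ε i * Real.sqrt E₀
                  = r ^ (m + 1) * G m * ε i + (r ^ (m + 1) * (r ^ (m + 1))⁻¹) * (κ (m + 1) * ε i * Real.sqrt E₀) := by
                    rw [h1, one_mul]
                _ = r ^ (m + 1) * (G m + Real.sqrt E₀ * (κ (m + 1) * (r ^ (m + 1))⁻¹)) * ε i := by ring
  have henv' : ∀ l i, x l i ≤ r ^ l * G l * ε i := fun l i => henv l l le_rfl i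
  -- the read-out
  set W : ℝ := ∑ k ∈ Finset.range (n + 1), ϖ k * (ρ ^ k)⁻¹ with hW
  have hpart2 : ∀ S : Finset Idx, (∑ k ∈ Finset.range (n + 1), ∑ i ∈ S, Pd k i * x (n - k) i) ≤ r ^ n * G n * W := by
    intro S
    calc (∑ k ∈ Finset.range (n + 1), ∑ i ∈ S, Pd k i * x (n - k) i)
        ≤ ∑ k ∈ Finset.range (n + 1), ∑ i ∈ S, Pd k i * (r ^ n * G n * ((ρ ^ k)⁻¹ * ε i)) := by
          refine Finset.sum_le_sum fun k hk => Finset.sum_le_sum fun i _ => mul_le_mul_of_nonneg_left ?_ (hPd k i)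
          have hkn : k ≤ n := by simpa [Finset.mem_range, Nat.lt_succ_iff] using hk
          calc x (n - k) i ≤ r ^ (n - k) * G (n - k) * ε i := henv' _ i
            _ ≤ (r ^ n * (ρ ^ k)⁻¹) * G n * ε i :=
                mul_le_mul_of_nonneg_right
                  (mul_le_mul (pow_sub_le_mul_inv hρ hρr hkn) (hGmono (by omega)) (hG0 _)
                    (mul_nonneg (pow_nonneg hr0.le _) (inv_nonneg.mpr (pow_nonneg hρ.le _))))
                  (hε i).le
            _ = r ^ n * G n * ((ρ ^ k)⁻¹ * ε i) := by ring
      _ = r ^ n * G n * ∑ k ∈ Finset.range (n + 1), (ρ ^ k)⁻¹ * ∑ i ∈ S, Pd k i * ε i := by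
          rw [Finset.mul_sum]
          refine Finset.sum_congr rfl fun k _ => ?_
          rw [Finset.mul_sum, Finset.mul_sum]
          exact Finset.sum_congr rfl fun i _ => by ring
      _ ≤ r ^ n * G n * W := by
          refine mul_le_mul_of_nonneg_left ?_ (mul_nonneg (pow_nonneg hr0.le _) (hG0 _))
          rw [hW]
          refine Finset.sum_le_sum fun k _ => ?_
          rw [mul_comm (ϖ k)]
          exact mul_le_mul_of_nonneg_left (hϖ k S) (inv_nonneg.mpr (pow_nonneg hρ.le _))
  have hread' := hread (r ^ n * G n * W) hpart2
  -- `G n ≤ √E₀ Σ κ ρ^{-l}` and the product bound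
  have hGn : G n ≤ Real.sqrt E₀ * ∑ l ∈ Finset.range (n + 1), κ l * (ρ ^ l)⁻¹ := by
    simp only [hG]
    refine mul_le_mul_of_nonneg_left (Finset.sum_le_sum fun l _ => mul_le_mul_of_nonneg_left ?_ (hκ l)) hsq0
    exact inv_anti₀ (pow_pos hρ l) (pow_le_pow_left₀ hρ.le hρr l)
  have hprod : G n * W ≤ Real.sqrt E₀ * Γ := by
    have hW0 : 0 ≤ W := by
      rw [hW]
      refine Finset.sum_nonneg fun k _ => mul_nonneg ?_ (inv_nonneg.mpr (pow_nonneg hρ.le _))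
      exact le_trans (Finset.sum_nonneg fun i _ => mul_nonneg (hPd k i) (hε i).le) (hϖ k ∅) |>.trans' (by simp)
    calc G n * W ≤ (Real.sqrt E₀ * ∑ l ∈ Finset.range (n + 1), κ l * (ρ ^ l)⁻¹) * W :=
          mul_le_mul_of_nonneg_right hGn hW0
      _ = Real.sqrt E₀ * ((∑ l ∈ Finset.range (n + 1), κ l * (ρ ^ l)⁻¹) * W) := by ring
      _ ≤ Real.sqrt E₀ * Γ := mul_le_mul_of_nonneg_left (by rw [hW]; exact hΓ n) hsq0
  have hrn : r ^ n ≤ L ^ n := pow_le_pow_left₀ hr0.le (by rw [hr, hL]; exact hrL) n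
  have hρn : ρ ^ n ≤ r ^ n := pow_le_pow_left₀ hρ.le hρr n
  have hL0 : 0 ≤ L := by rw [hL]; positivity
  have key : Real.sqrt Et ≤ Real.sqrt E₀ * L ^ (n + 2) := by
    calc Real.sqrt Et ≤ B * (r ^ n * G n * W) + cR n * Real.sqrt E₀ := hread'
      _ = r ^ n * (B * (G n * W)) + cR n * Real.sqrt E₀ := by ring
      _ ≤ r ^ n * (B * (Real.sqrt E₀ * Γ)) + (Cc * ρ ^ n) * Real.sqrt E₀ :=
          add_le_add (mul_le_mul_of_nonneg_left (mul_le_mul_of_nonneg_left hprod hB) (pow_nonneg hr0.le _))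
            (mul_le_mul_of_nonneg_right (hcR n).2 hsq0)
      _ ≤ r ^ n * (B * (Real.sqrt E₀ * Γ)) + (Cc * r ^ n) * Real.sqrt E₀ :=
          add_le_add le_rfl (mul_le_mul_of_nonneg_right (mul_le_mul_of_nonneg_left hρn hCc) hsq0)
      _ = Real.sqrt E₀ * (B * Γ + Cc) * r ^ n := by ring
      _ ≤ Real.sqrt E₀ * L ^ 2 * L ^ n :=
          mul_le_mul (mul_le_mul_of_nonneg_left hBL hsq0) hrn (pow_nonneg hr0.le n)
            (mul_nonneg hsq0 (pow_nonneg hL0 2))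
      _ = Real.sqrt E₀ * L ^ (n + 2) := by ring
  have hsq : Et ≤ E₀ * (L ^ (n + 2)) ^ 2 := by
    have hh := pow_le_pow_left₀ (Real.sqrt_nonneg _) key 2
    rwa [Real.sq_sqrt hEt, mul_pow, Real.sq_sqrt hE₀] at hh
  calc Et ≤ E₀ * (L ^ (n + 2)) ^ 2 := hsq
    _ = L ^ (2 * (n + 2)) * E₀ := by rw [← pow_mul, mul_comm (n + 2) 2]; ring

end Algebra

/-! ## 2. The crux of record (SHAPE Q v2 text verbatim) and the index set -/

/-- **WEAKEST K2 AT THE K1loc′ POINT** — route-2's crux of record under SHAPE Q v2 (arbiter A25-8; text of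
`HOME/ad-ideate-p1/r25/route2-shapeP/R1_shapeQ_v2.lean` VERBATIM; the Theses decl appears when the pen-holder edit lands). -/
def K2GrowthCtgPointH : Prop :=
  ∃ δ₀ ∈ Set.Ioc (0 : ℝ) ((2 : ℝ)⁻¹ ^ 100), K2PhaseGrowthClassicalH ⟨8, δ₀, 2, 1, 2⟩ 5

/-- The bookkeeping index: (piece type, shell). -/
abbrev Idx : Type := PType × ℕ

/-! ## 3. The window-corrected entry clause (the admissibility predicate of record) -/

/-- **`EntryBoundsW θ K₀ M D`** — the ENTRY CLAUSE of `RenewalConeInvariant` over the v1.3 (window-corrected, F1) predicates: `M i j` bounds the fresh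
shell-transfer entry `j ↦ i` and `D k i j` the age-`k` debris-transfer entry, uniformly in the truncation `K ≥ K₀` and the class `(α, β) ∈ [0,1)²`.
This is the `Adm` the assembly is instantiated with. -/
def EntryBoundsW (θ : ℝ) (K₀ : ℕ) (M : Idx → Idx → ℝ) (D : ℕ → Idx → Idx → ℝ) : Prop :=
  ∀ K : ℕ, K₀ ≤ K → ∀ α β : ℝ, α ∈ Set.Ico (0 : ℝ) 1 → β ∈ Set.Ico (0 : ℝ) 1 →
    ∀ i j : Idx, Transfer α β θ K j.1 j.2 i.1 i.2 (M i j) ∧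
      ∀ k : ℕ, 1 ≤ k → DebrisTransfer α β θ K k j.1 j.2 i.1 i.2 (D k i j)

/-! ## 3b. The v7 ENTRY BOOK (arbiter A27-9 (1) / A27-9′; source of truth `HOME/ad-ideate-p4/k2-spk/taskA/matrix_S7_cells.json`) and `EntryBoundsW7` -/

/-- **(i) core→far, PER CORE COLUMN — THE 20 CONSTANTS** (A27-9 (1)(i) / A27-9′ (2); `matrix_S7_cells.json` family `corecol`, 500 cells): `coreFar7 t′ t s` =
the cap of the fresh-transfer entry into the first far shell `(t′, 5)` from the core column `(t, s)`, `s ≤ 4`, = (3/2) × the measured all-class-max energy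
amplitude `E5` (custody K ≤ 192, six classes ∪ j328085 K384) ROUNDED UP to the next 1/1000; farther targets `(t′, s′)`, `s′ ≥ 5`, are capped at
`coreFar7 t′ t s · 2^{-(s′-5)}` (the certificate's witness is `(3/2)·E5·2^{-(s′-5)}` exactly; column shape ×0.46–0.50 per target octave measured over
`s′ = 5…8`, K192/K384, K768 job j328465 pending at file time).  `E5`: (V,5)←(V,0…4) .329 .117 .2059 .133 .1812, ←(H,0…4) .264 .3525 .2858 .1701 .2187;
(H,5)←(V,0…4) .0365 .032 .051 .092 .185, ←(H,0…4) .165 .053 .047 .05 .063.  (Arguments: target type, source type, source shell; junk 0 for `s ≥ 5`.) -/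
def coreFar7 : PType → PType → ℕ → ℝ
  | PType.V, PType.V, s => if s = 0 then 494/1000 else if s = 1 then 176/1000 else if s = 2 then 309/1000 else if s = 3 then 200/1000 else if s = 4 then 272/1000 else 0
  | PType.V, PType.H, s => if s = 0 then 396/1000 else if s = 1 then 529/1000 else if s = 2 then 429/1000 else if s = 3 then 256/1000 else if s = 4 then 329/1000 else 0
  | PType.H, PType.V, s => if s = 0 then 55/1000 else if s = 1 then 48/1000 else if s = 2 then 77/1000 else if s = 3 then 138/1000 else if s = 4 then 278/1000 else 0
  | PType.H, PType.H, s => if s = 0 then 248/1000 else if s = 1 then 80/1000 else if s = 2 then 71/1000 else if s = 3 then 75/1000 else if s = 4 then 95/1000 else 0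

/-- **(ii-a) V←H ECHO DIAGONALS** (A27-9 (1)(ii); A27-8; memo §10.1 / TABLE 10; `matrix_S7_cells.json` family `echo_diag`, 116 cells): `echo7 Δ = (3/2)·E_Δ`, the cap
of the entry `(H, s′+Δ) → (V, s′)`, flat along the diagonal (scale-invariance hypothesis of §10.1), `E = (28.6, 51.7, 45.5, 37.8, 30, 4)` for `Δ = 6…11`
(decimals confirmed by p4; `E_10 = 30` provisional until K4096 j327614); caps 42.9 / 77.55 / 68.25 / 56.7 / 45 / 6.  Junk 0 outside `Δ = 6…11`. -/
def echo7 (Δ : ℕ) : ℝ :=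
  if Δ = 6 then 429/10 else if Δ = 7 then 1551/20 else if Δ = 8 then 273/4 else if Δ = 9 then 567/10 else if Δ = 10 then 45 else if Δ = 11 then 6 else 0

/-- First capped target shell of the echo diagonal `Δ`: `s′ ≥ 2` (`Δ = 6…10`), `s′ ≥ 3` (`Δ = 11`) — below, the v6 law already exceeds `(3/2)·E_Δ` and stays the
(un-capped) witness (`matrix_S7_cells.json`: amended = `max(v6, (3/2)E_Δ)` raised cells only). -/
def echoStart (Δ : ℕ) : ℕ := if Δ = 11 then 3 else 2

/-- **(ii-b) V→H CREATION BAND** (A27-9 (1)(ii); memo §10.5 / j327227, aligned-input control A27-8 (3); `matrix_S7_cells.json` family `vh_band`, 82 cells):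
`band7 Δ = (3/2)·F_Δ`, the cap of the entry `(V, s′+Δ) → (H, s′)`, flat along the diagonal, `F = (1.13, 2.6, 2.45, 0.63, 0.18)` for `Δ = 2…6` (these ALREADY include
the 6–12 % uplift over the raw K1024 sups 1.06 / 2.39 / 2.32 / 0.56 / 0.17 — p4: the extra factor 1.06 written in A27-9 (1)(ii) is not in the matrix); caps 1.695 / 3.9 /
3.675 / 0.945 / 0.27.  Flatness for `s′ ≥ 7` is p2's analytic column (`K2FarRowsR1-p2.md`).  Junk 0 outside `Δ = 2…6`. -/
def band7 (Δ : ℕ) : ℝ :=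
  if Δ = 2 then 1695/1000 else if Δ = 3 then 39/10 else if Δ = 4 then 3675/1000 else if Δ = 5 then 945/1000 else if Δ = 6 then 27/100 else 0

/-- First capped target shell of the creation-band diagonal `Δ`: 7 / 6 / 7 / 12 / 16 for `Δ = 2…6` — below, the v6 moving-band law exceeds `(3/2)·F_Δ` and stays the
(un-capped) witness (`matrix_S7_cells.json`: amended = raised cells only).  Junk 0 outside `Δ = 2…6` (unused). -/
def bandStart (Δ : ℕ) : ℕ :=
  if Δ = 2 then 7 else if Δ = 3 then 6 else if Δ = 4 then 7 else if Δ = 5 then 12 else if Δ = 6 then 16 else 0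

/-- **`BookV7 M` — THE v7 LAW BOOK as typed caps on the fresh-transfer family** (`M i j`, target `i = (t′, s′)`, source `j = (t, s)`), on exactly the 698 amended cells
of `matrix_S7_cells.json` (shells ≤ 29) extended along each column / diagonal to all shells: (i) every core→far cell under its per-core-column law; (ii-a) the V←H
echo diagonals `Δ = 6…11` from `echoStart Δ` on; (ii-b) the V→H creation-band diagonals `Δ = 2…6` from `bandStart Δ` on.  NOTHING ELSE is constrained (A27-9
(1)(iii): H→H unchanged = free as in v6; core×core, the other far→core / far→far cells and all debris entries `D k` likewise — their truth is carried by `EntryBoundsW`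
alone, their size by the cone certificate).  `≤` («booked WITHIN the law», A27-9′ (1)): `EntryBoundsW7` is satisfiable iff the true sups are ≤ the caps on these cells
(the falsifiable content of A27-9 (1)); no cap sits below the certificate's witness value nor below (3/2)× the measured class-max (A27-9′ (2)). -/
def BookV7 (M : Idx → Idx → ℝ) : Prop :=
  (∀ (t' t : PType) (s' s : ℕ), s ≤ 4 → 5 ≤ s' → M (t', s') (t, s) ≤ coreFar7 t' t s * (2 : ℝ)⁻¹ ^ (s' - 5)) ∧
  (∀ (s' Δ : ℕ), 6 ≤ Δ → Δ ≤ 11 → echoStart Δ ≤ s' → M (PType.V, s') (PType.H, s' + Δ) ≤ echo7 Δ) ∧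
  (∀ (s' Δ : ℕ), 2 ≤ Δ → Δ ≤ 6 → bandStart Δ ≤ s' → M (PType.H, s') (PType.V, s' + Δ) ≤ band7 Δ)

/-- **`EntryBoundsW7 θ K₀ M D`** — THE v7 ADMISSIBILITY PREDICATE OF RECORD (A27-9 (4) / A27-9′): the v6 window-corrected entry clause `EntryBoundsW θ K₀ M D`
(every `M i j` / `D k i j` truly bounds the fresh / age-`k` debris shell transfer, uniformly in `K ≥ K₀` and the class) AND the v7 law book `BookV7 M`. -/
def EntryBoundsW7 (θ : ℝ) (K₀ : ℕ) (M : Idx → Idx → ℝ) (D : ℕ → Idx → Idx → ℝ) : Prop :=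
  EntryBoundsW θ K₀ M D ∧ BookV7 M

/-- The book's caps are nonnegative (so `BookV7` is compatible with `0 ≤ M`). -/
theorem coreFar7_nonneg (t' t : PType) (s : ℕ) : 0 ≤ coreFar7 t' t s := by
  cases t' <;> cases t <;> simp only [coreFar7] <;> split_ifs <;> norm_num

/-- Nonnegativity of the echo caps. -/
theorem echo7_nonneg (Δ : ℕ) : 0 ≤ echo7 Δ := by
  simp only [echo7]; split_ifs <;> norm_num

/-- Nonnegativity of the creation-band caps. -/
theorem band7_nonneg (Δ : ℕ) : 0 ≤ band7 Δ := by
  simp only [band7]; split_ifs <;> norm_num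

/-- `EntryBoundsW7` refines `EntryBoundsW` (projection). -/
theorem entryBoundsW_of_W7 {θ : ℝ} {K₀ : ℕ} {M : Idx → Idx → ℝ} {D : ℕ → Idx → Idx → ℝ}
    (h : EntryBoundsW7 θ K₀ M D) : EntryBoundsW θ K₀ M D := h.1

/-! ## 4. The reshaped material representation (companion §2, VERBATIM) -/

/-- **MATERIAL REPRESENTATION AT `P`, RESHAPED (`MatRepAt′`).**  PDE binders VERBATIM as in v3 (`K2PhaseGrowthClassicalH`'s class, phases
`j₀ < J < Jrate (γ²−3) ν + A`); the conclusion at each `t` of phase `J`'s window is the abstract bookkeeping predicate `GenBook` at generation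
`n = J − j₀ − 1` with input energy `‖w₀‖²` and current energy `‖w(t)‖²`.  `Adm` = the admissibility predicate of entry families (v4: the
window-corrected `EntryBoundsW 8 K₀`); `η` = per-phase slack; `ι` = comb-lineage creation profile by age (`ι 0` = injection); `Pd` = debris
read-out weights by age; `cR` = comb remnant read-out by age. -/
def MatRepAt' (P : CascadeParams) (Adm : (Idx → Idx → ℝ) → (ℕ → Idx → Idx → ℝ) → Prop) (η B : ℝ) (ι : ℕ → Idx → ℝ)
    (Pd : ℕ → Idx → ℝ) (cR : ℕ → ℝ) : Prop :=
  ∀ A : ℕ, ∃ ν₀ : ℝ, 0 < ν₀ ∧ ∀ ν ∈ Set.Ioc 0 ν₀, ∀ (j₀ J : ℕ), j₀ < J → J < Jrate (P.γ ^ 2 - 3) ν + A → ∀ (hz : Bool)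
    (w₀ : UnitAddTorus (Fin 2) → EuclideanSpace ℝ (Fin 2))
    (w : ℝ → UnitAddTorus (Fin 2) → EuclideanSpace ℝ (Fin 2)) (q : ℝ → UnitAddTorus (Fin 2) → ℝ),
    ShearCombDatum (P.N j₀) hz w₀ →
    Torus.IsSmoothSpaceTimeOn (Set.Icc (CascadeParams.tInject j₀ hz) (CascadeParams.tStart (J + 1))) w →
    Torus.IsSmoothSpaceTimeOn (Set.Icc (CascadeParams.tInject j₀ hz) (CascadeParams.tStart (J + 1))) q →
    (∀ t ∈ Set.Icc (CascadeParams.tInject j₀ hz) (CascadeParams.tStart (J + 1)), Torus.IsDivFree (w t)) →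
    (∀ t ∈ Set.Icc (CascadeParams.tInject j₀ hz) (CascadeParams.tStart (J + 1)), ∀ x,
      Torus.timeDerivWithin (Set.Icc (CascadeParams.tInject j₀ hz) (CascadeParams.tStart (J + 1))) w t x +
        Torus.convect (P.field t) (w t) x + Torus.convect (w t) (P.field t) x =
        ν • Torus.laplacian (w t) x - Torus.gradient (q t) x) →
    w (CascadeParams.tInject j₀ hz) = w₀ →
    ∀ t ∈ Set.Icc (max (CascadeParams.tInject j₀ hz) (CascadeParams.tStart J)) (CascadeParams.tStart (J + 1)),
      GenBook Adm η B ι Pd cR (J - j₀ - 1) (Torus.vectorL2Sq w₀) (Torus.vectorL2Sq (w t))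

/-- `MatRepAt′` at SOME corner rounding `δ₀ ∈ (0, 2⁻¹⁰⁰]` of the design point (the `∃ δ₀` of the crux); `Adm` may depend on nothing else. -/
def MaterialRepresentation' (Adm : (Idx → Idx → ℝ) → (ℕ → Idx → Idx → ℝ) → Prop) (η B : ℝ) (ι : ℕ → Idx → ℝ)
    (Pd : ℕ → Idx → ℝ) (cR : ℕ → ℝ) : Prop :=
  ∃ δ₀ ∈ Set.Ioc (0 : ℝ) ((2 : ℝ)⁻¹ ^ 100), MatRepAt' ⟨8, δ₀, 2, 1, 2⟩ Adm η B ι Pd cR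

/-! ## 5. The assembly (companion §2, VERBATIM): S3′ + S-2′ + budget ⇒ `K2PhaseGrowthClassicalH` ⇒ the crux ⇒ the Target -/

private theorem vectorL2Sq_nonneg (v : UnitAddTorus (Fin 2) → EuclideanSpace ℝ (Fin 2)) : 0 ≤ Torus.vectorL2Sq v := by
  unfold Torus.vectorL2Sq
  exact MeasureTheory.integral_nonneg fun _ => by positivity

/-- **S3′ + S-2′ + budget ⇒ the horizon cap 5 at `P`** (`P.γ = 8`, `P.δ₀ > 0`, `P.d > 0`): `J = j₀` is the landed `k2_injectionPhase_cap5`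
(every `ν > 0`); `J > j₀` is `GenBook.readout_le`. -/
theorem k2PhaseGrowthClassicalH_of_matRep' (P : CascadeParams) (hγ : P.γ = 8) (hδ₀ : 0 < P.δ₀) (hd : 0 < P.d)
    {Adm : (Idx → Idx → ℝ) → (ℕ → Idx → Idx → ℝ) → Prop} {ρ η B Γ Cc : ℝ} {ι : ℕ → Idx → ℝ} {Pd : ℕ → Idx → ℝ} {cR : ℕ → ℝ}
    (h3 : ConeP Adm ρ ι Pd cR Γ Cc) (h2 : MatRepAt' P Adm η B ι Pd cR) (hb : BudgetP ρ η B Γ Cc) :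
    K2PhaseGrowthClassicalH P 5 := by
  intro A
  obtain ⟨ν₀, hν₀, H⟩ := h2 A
  refine ⟨ν₀, hν₀, ?_⟩
  intro ν hν j₀ J hj hJ hz w₀ w q hdat hw hq hdiv hlin h0 t ht
  rcases Nat.eq_or_lt_of_le hj with hJj | hlt
  · subst hJj
    exact Summit.AnomalousDissipation.AnomalousDissipation.Theorems.SawtoothPulseCascade.K2Classical.k2_injectionPhase_cap5
      P (by rw [hγ]; norm_num) (le_of_eq hγ) hδ₀ hd hν.1 j₀ hz w₀ w q hdat hw hq hdiv hlin h0 t ht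
  · have hGB := H ν hν j₀ J hlt hJ hz w₀ w q hdat hw hq hdiv hlin h0 t ht
    have hmain := GenBook.readout_le hGB h3 hb (vectorL2Sq_nonneg w₀) (vectorL2Sq_nonneg (w t))
    have hexp : J + 1 - j₀ = (J - j₀ - 1) + 2 := by omega
    rw [hexp, hγ]
    exact hmain

/-- **`K2GrowthCtgPointH_of′` — THE RESHAPED S4 ASSEMBLY.** -/
theorem K2GrowthCtgPointH_of' {Adm : (Idx → Idx → ℝ) → (ℕ → Idx → Idx → ℝ) → Prop} {ρ η B Γ Cc : ℝ}
    {ι : ℕ → Idx → ℝ} {Pd : ℕ → Idx → ℝ} {cR : ℕ → ℝ}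
    (h3 : ConeP Adm ρ ι Pd cR Γ Cc) (h2 : MaterialRepresentation' Adm η B ι Pd cR) (hb : BudgetP ρ η B Γ Cc) :
    K2GrowthCtgPointH := by
  obtain ⟨δ₀, hδ₀, hrep⟩ := h2
  exact ⟨δ₀, hδ₀, k2PhaseGrowthClassicalH_of_matRep' ⟨8, δ₀, 2, 1, 2⟩ rfl hδ₀.1 (by norm_num) h3 hrep hb⟩

/-- The cone with profile data over `EntryBoundsW θ K₀` implies p4's frozen `RenewalConeInvariant θ ρ K₀` (projection). -/
theorem renewalConeInvariant_of_coneP {θ ρ Γ Cc : ℝ} {K₀ : ℕ} {ι : ℕ → Idx → ℝ} {Pd : ℕ → Idx → ℝ} {cR : ℕ → ℝ}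
    (h : ConeP (EntryBoundsW θ K₀) ρ ι Pd cR Γ Cc) : RenewalConeInvariant θ ρ K₀ := by
  obtain ⟨ε, hε, M, D, hM, hD, hEB, hcone, -⟩ := h
  exact ⟨ε, hε, M, D, hM, hD, hEB, hcone⟩

/-! ## 5b. v7 bridges: `ConeP` is monotone and `MaterialRepresentation'` antitone in the admissibility predicate -/

/-- `ConeP` is MONOTONE in `Adm` (the cone exhibits ONE admissible family). -/
theorem coneP_mono {Adm Adm' : (Idx → Idx → ℝ) → (ℕ → Idx → Idx → ℝ) → Prop} (hA : ∀ M D, Adm M D → Adm' M D)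
    {ρ Γ Cc : ℝ} {ι : ℕ → Idx → ℝ} {Pd : ℕ → Idx → ℝ} {cR : ℕ → ℝ}
    (h : ConeP Adm ρ ι Pd cR Γ Cc) : ConeP Adm' ρ ι Pd cR Γ Cc := by
  obtain ⟨ε, hε, M, D, hM, hD, hAdm, hrest⟩ := h
  exact ⟨ε, hε, M, D, hM, hD, hA M D hAdm, hrest⟩

/-- `GenBook` is ANTITONE in `Adm` ((R1η) quantifies over EVERY admissible family). -/
theorem genBook_anti {Adm Adm' : (Idx → Idx → ℝ) → (ℕ → Idx → Idx → ℝ) → Prop} (hA : ∀ M D, Adm' M D → Adm M D)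
    {η B : ℝ} {ι : ℕ → Idx → ℝ} {Pd : ℕ → Idx → ℝ} {cR : ℕ → ℝ} {n : ℕ} {E₀ Et : ℝ}
    (h : GenBook Adm η B ι Pd cR n E₀ Et) : GenBook Adm' η B ι Pd cR n E₀ Et := by
  obtain ⟨x, hxnn, hx0, hstep, hread⟩ := h
  exact ⟨x, hxnn, hx0, fun M D hM hD hAdm => hstep M D hM hD (hA M D hAdm), hread⟩

/-- `MatRepAt'` is ANTITONE in `Adm`. -/
theorem matRepAt'_anti {Adm Adm' : (Idx → Idx → ℝ) → (ℕ → Idx → Idx → ℝ) → Prop} (hA : ∀ M D, Adm' M D → Adm M D)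
    {P : CascadeParams} {η B : ℝ} {ι : ℕ → Idx → ℝ} {Pd : ℕ → Idx → ℝ} {cR : ℕ → ℝ}
    (h : MatRepAt' P Adm η B ι Pd cR) : MatRepAt' P Adm' η B ι Pd cR := by
  intro A
  obtain ⟨ν₀, hν₀, H⟩ := h A
  refine ⟨ν₀, hν₀, ?_⟩
  intro ν hν j₀ J hj hJ hz w₀ w q hdat hw hq hdiv hlin h0 t ht
  exact genBook_anti hA (H ν hν j₀ J hj hJ hz w₀ w q hdat hw hq hdiv hlin h0 t ht)

/-- `MaterialRepresentation'` is ANTITONE in `Adm`. -/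
theorem materialRepresentation'_anti {Adm Adm' : (Idx → Idx → ℝ) → (ℕ → Idx → Idx → ℝ) → Prop} (hA : ∀ M D, Adm' M D → Adm M D)
    {η B : ℝ} {ι : ℕ → Idx → ℝ} {Pd : ℕ → Idx → ℝ} {cR : ℕ → ℝ}
    (h : MaterialRepresentation' Adm η B ι Pd cR) : MaterialRepresentation' Adm' η B ι Pd cR := by
  obtain ⟨δ₀, hδ₀, hrep⟩ := h
  exact ⟨δ₀, hδ₀, matRepAt'_anti hA hrep⟩

/-- **S3′ v7 ⇒ S3′ v6**: a cone over the v7 book is a cone over the bare v6 entry clause. -/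
theorem coneP_W_of_W7 {θ ρ Γ Cc : ℝ} {K₀ : ℕ} {ι : ℕ → Idx → ℝ} {Pd : ℕ → Idx → ℝ} {cR : ℕ → ℝ}
    (h : ConeP (EntryBoundsW7 θ K₀) ρ ι Pd cR Γ Cc) : ConeP (EntryBoundsW θ K₀) ρ ι Pd cR Γ Cc :=
  coneP_mono (fun _ _ hMD => hMD.1) h

/-- **S-2′ v6 ⇒ S-2′ v7**: a material representation against every v6-admissible family is one against every v7-booked family. -/
theorem matRep_W7_of_W {θ η B : ℝ} {K₀ : ℕ} {ι : ℕ → Idx → ℝ} {Pd : ℕ → Idx → ℝ} {cR : ℕ → ℝ}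
    (h : MaterialRepresentation' (EntryBoundsW θ K₀) η B ι Pd cR) : MaterialRepresentation' (EntryBoundsW7 θ K₀) η B ι Pd cR :=
  materialRepresentation'_anti (fun _ _ hMD => hMD.1) h

/-- The v7 cone implies p4's frozen `RenewalConeInvariant θ ρ K₀` (projection). -/
theorem renewalConeInvariant_of_coneP7 {θ ρ Γ Cc : ℝ} {K₀ : ℕ} {ι : ℕ → Idx → ℝ} {Pd : ℕ → Idx → ℝ} {cR : ℕ → ℝ}
    (h : ConeP (EntryBoundsW7 θ K₀) ρ ι Pd cR Γ Cc) : RenewalConeInvariant θ ρ K₀ :=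
  renewalConeInvariant_of_coneP (coneP_W_of_W7 h)

/-! ## 6. The line of record: constants (A26-11/A26-13; unchanged, A27-9 (2)), the TABLES OF RECORD (WO-p4-K2-7, memo §9.5, far-lineage book R-b), the two stubs OVER THE v7 BOOK `EntryBoundsW7 8 K₀c` (A27-9 (4) / A27-9′), the proved budget, the composition -/

/-- Cone rate of record `ρc = 268/5 = 53.6` (renewal cone re-closed WITH the far floor `ε_s ≥ (3/50)·2^{-s/2}`, φ = 1.5, variant-robust; A26-11). -/
def ρc : ℝ := 268 / 5

/-- Per-phase slack of record `ηc = 1/10` (`(1+ηc)ρc = 58.96 ≤ 5e^{8σ⋆} ≈ 59.62`; the δ₀-layer / viscous deviation allowance of S-2′, F3). -/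
def ηc : ℝ := 1 / 10

/-- Truncation floor `K₀ = 24`. -/
def K₀c : ℕ := 24

/-- Read-out convention `Bc = 1` (all read-out weight sits in the age-graded table `Pdc`, memo §4). -/
def Bc : ℝ := 1

/-- **TABLE OF RECORD `ιc` — comb-lineage creation profile BY AGE** (memo §9.5 verbatim; WO-p4-K2-7, 18 kit jobs, engine `wo_p4_k2_7.py`; R-b).
`i = (type, shell)`.  Far cells `s ≥ 5`: STRUCTURAL zero (R-b: far-born comb progeny is LINEAGE, book FL, read out via `cRc`, re-injected into shells
`≤ 4` at ages `n ≥ 2` through the FL term below — nothing is dropped).  Age 0: the V-slot creation from the comb `(63/50)·(71/100)^(s-1)`, `1 ≤ s ≤ 4`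
(E5 + 5 %; exact 0 for `hz = false`); age 1: all-comb K64 sups × 1.15; ages `n ≥ 2`: remnant feed + far-lineage feed `A_FL·U_ℓ²(i)·g^(n-2)` at the
far-block one-phase gain of record `g = 13` (E6: any `g ≤ 40` keeps the budget, A26-13 (3a)).  Law-completed engine maxima, NOT certified (memo §9.6). -/
def ιc : ℕ → Idx → ℝ := fun n i =>
  if 5 ≤ i.2 then 0   -- R-b: far-born comb progeny is lineage (book FL), never injected
  else if n = 0 then (if i.1 = PType.V ∧ 1 ≤ i.2 then (63/50) * (71/100) ^ (i.2 - 1) else 0)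
  else if n = 1 then   -- all-comb age-1 feed (K64 sups ×1.15)
    (if i.1 = PType.V then (if i.2 = 0 then 23/50 else if i.2 = 1 then 341/25 else if i.2 = 2 then 71/20 else if i.2 = 3 then 43/25 else if i.2 = 4 then 41/50 else 0)
     else (if i.2 = 0 then 851/100 else if i.2 = 1 then 63/100 else if i.2 = 2 then 2/5 else if i.2 = 3 then 8/25 else if i.2 = 4 then 9/20 else 0))
  else   -- n ≥ 2: remnant feed + far-lineage feed A_FL·U_ℓ²(i)·g^(n-2)
    (if i.1 = PType.V then (if i.2 = 0 then 22/25 else if i.2 = 1 then 9/25 else if i.2 = 2 then 1/25 else if i.2 = 3 then 3/100 else if i.2 = 4 then 1/50 else 0) + (if i.2 = 0 then 643 else if i.2 = 1 then 357 else if i.2 = 2 then 118 else if i.2 = 3 then 41 else if i.2 = 4 then 18 else 0) * (13:ℝ) ^ (n - 2)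
     else (if i.2 = 0 then 1/25 else if i.2 = 1 then 3/50 else if i.2 = 2 then 3/100 else if i.2 = 3 then 3/100 else if i.2 = 4 then 1/50 else 0) + (if i.2 = 0 then 288 else if i.2 = 1 then 277 else if i.2 = 2 then 145 else if i.2 = 3 then 101 else if i.2 = 4 then 70 else 0) * (13:ℝ) ^ (n - 2))

/-- **TABLE OF RECORD `Pdc` — age-graded read-out weights** (memo §9.5 verbatim): age 0 measured × 1.15 (K24 10 classes + K32 3 classes, shells `≤ 5`),
far V flat `1513/50` / `413/5` (E2: V emission flat), far H `80` to `s = 8` then the DECAYING law `80·(71/100)^(s-8)` (E2 ℓ² form); ages `k ≥ 1` flat in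
age (E4).  No hard cut-off.  Law-completed engine maxima, NOT certified. -/
def Pdc : ℕ → Idx → ℝ := fun k i =>
  if k = 0 then
    (if i.1 = PType.V then (if i.2 = 0 then 1589/100 else if i.2 = 1 then 1627/100 else if i.2 = 2 then 1233/100 else if i.2 = 3 then 284/25 else if i.2 = 4 then 1513/50 else if i.2 = 5 then 197/10 else 1513/50)
     else (if i.2 = 0 then 1523/100 else if i.2 = 1 then 1759/100 else if i.2 = 2 then 64/5 else if i.2 = 3 then 849/50 else if i.2 = 4 then 179/10 else if i.2 = 5 then 1717/100 else if i.2 ≤ 8 then 80 else 80 * (71/100) ^ (i.2 - 8)))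
  else -- k ≥ 1: flat in age
    (if i.1 = PType.V then (if i.2 = 0 then 246/25 else if i.2 = 1 then 1247/50 else if i.2 = 2 then 83/2 else if i.2 = 3 then 1587/50 else if i.2 = 4 then 2629/50 else if i.2 = 5 then 413/5 else 413/5)
     else (if i.2 = 0 then 493/50 else if i.2 = 1 then 919/100 else if i.2 = 2 then 109/10 else if i.2 = 3 then 492/25 else if i.2 = 4 then 5439/100 else if i.2 = 5 then 1178/25 else if i.2 ≤ 8 then 80 else 80 * (71/100) ^ (i.2 - 8)))

/-- **TABLE OF RECORD `cRc` — the far-lineage (FL) read-out by age** (memo §9.5 verbatim): `cR 0 = 76/5` (the P3 comb event), `cR n = 678·13^(n-1)` for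
`n ≥ 1` (own content + ℓ²-coherent emission of the lineage at far-block gain `g = 13`); `≤ Ccc·ρc^n` since `678 ≤ (76/5)·(268/5)` and `13 ≤ ρc`.  This is the
law S-2′ must certify K-UNIFORMLY (A26-13 (2b)); its K-uniformity is exactly SPK (F-k1loc-9). -/
def cRc : ℕ → ℝ := fun n => if n = 0 then 76/5 else 678 * (13:ℝ) ^ (n - 1)

/-- **PROFILE COST OF RECORD `Γc = 730`** (`= ⌈1.05 × 688.0⌉₁₀`, `688.0 = (Σ κ_n ρ^{-n})·(Σ ϖ_k ρ^{-k}) = 11.060 × 62.205` on the floored profile of record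
`c = 3/50`; A26-13: stays 730 at `g = 13`, becomes 900 if P2-E6 lands with `25 < g ≤ 40` — a one-number edit, budget room then ×3.9). -/
def Γc : ℝ := 730

/-- **COMB-REMNANT COST OF RECORD `Ccc = 76/5`** (`cR 0 = 15.2`; `cR 1 = 678 ≤ Ccc·ρc = 814.7`). -/
def Ccc : ℝ := 76/5

/-- **STUB S3′ v7 (the renewal cone with profile data over the v7-BOOKED window-corrected entries `EntryBoundsW7 8 K₀c`, on the tables of record; owners: cert
design p4 (`K2ConeCertificateDesign.md` + v1.3 delta; certificate of record on the v7 matrix = `matrix_S7_cells.json` / `profile_S4v7.json`: ρ_floor = 52.29 ≤ ρc = 53.6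
(tight rows H7, V8, H6, H8), κ0 8.78 / κ1 23.32 / κ2 3635.11, Σκρ^{−n} 10.889, Σϖρ^{−k} 57.206, Γ = 622.9 ≤ Γc = 730, budget 638.1 ≤ 3540.25 — the v6 cone constants
UNCHANGED), entries p2 g11 (P2-Q1 list, memo §10; the analytic column `K2FarRowsR1-p2.md` makes (ii)'s flatness for `s′ ≥ 7` theorem-shaped), laws E2 (ℓ² form)/E4/
E5/E6; booking of record = PIECE LABEL on both sides = the typed `outEnergy` (A27-9 (3), §10.7-C5)).**  v7 = v6's S3′ with the exhibited `M` in addition capped by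
`BookV7` on the 698 amended cells (A27-9 (1)(i)(ii)) — superseded-by-STRONGER-with-certificate (A27-9′ (1)); `coneP_W_of_W7` recovers v6's statement. -/
theorem stub_S3_cone : ConeP (EntryBoundsW7 8 K₀c) ρc ιc Pdc cRc Γc Ccc := by
  sorry

/-- **STUB S-2′ v7 (the reshaped material representation on the tables of record, against every v7-BOOKED admissible family `EntryBoundsW7 8 K₀c`; owner: the K2
lane; text vetted by p4 g18; A26-13 (2a)/(2b)/(3); A27-9 (4) / A27-9′ (1): superseded-by-WEAKER, `matRep_W7_of_W`).**  A27-9 (1): the far→far families that the v6 law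
matrix booked at 0 (V←H echoes) / at moving-band values (V→H creation) now carry the measured ×3/2 flat diagonal caps, core→far is capped per core column (PHI ≥ measured
×1.9 / ×2.5 row-max evidence), H→H unchanged.
LINEAGE SET (R-b, of record): the comb remnant ∪ the far-born comb progeny (pieces created in shells `s ≥ 5` at any age), INCLUDING their re-injection
into shells `≤ 4` at ages `n ≥ 2` (booked in `ιc n`, `n ≥ 2`, FL term) — the structural zero `ιc n (t, s ≥ 5) = 0` drops nothing because the lineage is
read out through `cRc`.  WHAT S-2′ MUST CERTIFY K-UNIFORMLY (`∀ ν ≤ ν₀`, i.e. every truncation `K ≥ K₀c`): the generation book `GenBook (EntryBoundsW 8 K₀c)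
ηc Bc ιc Pdc cRc` of the true solution, in particular the FL read-out law `cRc n = 678·13^(n-1)` (`n ≥ 1`).  NAMED OPEN LAWS it rests on: **E6** (far-block
one-phase gain `g ≤ 40`; of record, measured 9.9/5.4 at K64, tables at `g = 13`; analytic version = P2-E6 from the single-mode creation law p697032) and
**SPK = F-k1loc-9, THE open law** (saturation of the H-column feed `(H,s) → (V,S0)`, 27 → 53 for `s = 6 → 7` at K192: if it keeps growing `∝ 2^{s/2}`
without saturation — Orr-type transit of far modes through low `|k|` inside one phase — then `cR n ≤ Ccc ρc^n` fails K-uniformly and this stub DIES with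
every profile design; kill criterion = kit WO-p4-K2-8 (`s = 5…9`, K = 384/512) × the analytic transit estimate P2-O).  Registration does not wait for SPK.
**SPK STATUS OF RECORD (arbiter A27-1 (i) / A27-1′, 2026-08-29 06:11Z/06:15Z; numerical, K-converged 384/512/768, engine cross-validated 1.5e-14 / 6.8e-6;
memo `K2SPKTest-p4g19.md`): F-k1loc-9 NOT FIRED — the far-H column feed `sup‖(H,s)→(V,S0)‖` is BOUNDED: it doubles only up to `s× = 7 = log₂(16γ)`
(per shell ≤ 56 over all classes), then decays geometrically (×0.88, ×0.83, ≲×0.6); coherent far union `ALL(S5..)→(V,S0) ≈ 85 ± 3`; `(V,s)→(V,S0)` union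
≤ 21.5; mechanism = double Orr echo (memo §5); the law matrix behind these tables (A7=2 · GROW=1 · SPK=9 · PHI=3/2) majorises the measured column row by
row (A27-1′: Γ/budget of record stand, no tables re-run).  PROVISO carried (A27-1′ → A27-2): tail `s ≥ 10` pending the v2 addendum (K = 1024/2048 exact
diag-only jobs: geometric decay vs plateau); the inherited next-cell far feed `(H,s)→(V,S1) ≈ 27` (`s = 9–10`) is a ROW the certificate must carry.** -/
theorem stub_S2_matRep : MaterialRepresentation' (EntryBoundsW7 8 K₀c) ηc Bc ιc Pdc cRc := by
  sorry

/-- `e^{8σ⋆} ≥ 11.9` (`8σ⋆ = 2.47856`; nine Taylor terms, `Real.sum_le_exp_of_nonneg`; true value 11.925). [folklore] -/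
theorem exp_eight_sawSigmaStar_ge' : (119 / 10 : ℝ) ≤ Real.exp (sawSigmaStar * 8) := by
  have hx : sawSigmaStar * 8 = (2.47856 : ℝ) := by simp only [sawSigmaStar]; norm_num
  rw [hx]
  have h := Real.sum_le_exp_of_nonneg (x := (2.47856 : ℝ)) (by norm_num) 9
  refine le_trans ?_ h
  simp only [Finset.sum_range_succ, Finset.sum_range_zero, Nat.factorial]
  norm_num

/-- **The budget holds for the constants and tables of record** (`(1+ηc)ρc = 58.96 ≤ 5·11.9 = 59.5`; `BcΓc + Ccc = 745.2 ≤ (5·11.9)² = 3540.25`, room ×4.75). -/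
theorem BudgetP_holds : BudgetP ρc ηc Bc Γc Ccc := by
  have h := exp_eight_sawSigmaStar_ge'
  refine ⟨by unfold ρc; norm_num, by unfold ηc; norm_num, by unfold Bc; norm_num, by unfold Ccc; norm_num, ?_, ?_⟩
  · unfold ηc ρc; nlinarith [h]
  · unfold Bc Γc Ccc; nlinarith [h, Real.exp_pos (sawSigmaStar * 8)]

/-- **THE COMPOSITION**: the crux of record from the two stubs and the proved budget. -/
theorem K2GrowthCtgPointH_holds : K2GrowthCtgPointH :=
  K2GrowthCtgPointH_of' stub_S3_cone stub_S2_matRep BudgetP_holds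

/-- **THE ROUTE-2 TARGET ITEM BY NAME** (stmt-AnomalousDissipation-20024; A26-8 (2)(c) / A26-10): the literal composition whose TYPE is the Theses decl
`Summit.AnomalousDissipation.AnomalousDissipation.Theses.SawtoothPulseCascade.Target`. -/
theorem Target_holds : Summit.AnomalousDissipation.AnomalousDissipation.Theses.SawtoothPulseCascade.Target :=
  Summit.AnomalousDissipation.AnomalousDissipation.Theorems.SawtoothPulseCascade.target_of_K2GrowthCtgPointH
    (K2GrowthCtgPointH_of' stub_S3_cone stub_S2_matRep BudgetP_holds)

end Summit.AnomalousDissipation.AnomalousDissipation.Cruxes.K1LocalisedCascade.K2S4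

end
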